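import Mathlib
import HarnessLib

/-!
# Müller–Schiemann, *Continuum limit of a hierarchical SU(2) lattice gauge theory in 4 dimensions*
# (CMP 110, 1987), proof of THEOREM 2 PART 4) (pp.281–282): the uniform bound (6.16)
# `|h(x + iy)| < exp{(1 + ε′)(κ/2)²β^{1−2α}}` on the strip `|y| < (κ/2)β^{−α}` from parts 2) and 3),
# and its scale-uniform form (6.17)–(6.18) — PROVED (the two regimes 2), 3) enter as hypotheses)

statement-level skeleton of published theorems with citation tags; proofs where landed; nothing here is a claim about the Yang–Mills mass gap

**Citation header (reproduction of PUBLISHED work).** V. F. Müller, J. Schiemann, *Continuum limit of a hierarchical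
SU(2) lattice gauge theory in 4 dimensions*, Commun. Math. Phys. **110** (1987) 261–286, doi 10.1007/BF01207367
[MullerSchiemann1987]; Theorem 2 parts 2)–4) and (6.16)–(6.18), journal pp. 281–282 (held Project Euclid scan
`paper:url-96df5da18d4c`; displays read by this seat on its own 3× page renders
`run/shared/lean/pub/lit-balaban/lit-balaban-p12/renders-cmp110ms/ms87-cmp110-pdfp021,022-journalp281,282-x3.png`).  Lean lane
of the lit-balaban YM LIT SWEEP CONTEXT row X1 (register level; zero weight for any token of that table); the model is the
`d = 4` HIERARCHICAL `SU(2)` gauge model, NOT lattice Yang–Mills.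

**What the paper prints (p.281 L.35 – p.282 L.9).** *«In order to prove 4) we first observe for given cutoff N and scale n
the bound, valid for |y| < (κ/2)(β_N^{(−n)})^{−α}, |h_N^{(−n)}(x + iy)| < exp{(1 + ε′)(κ/2)²(β_N^{(−n)})^{1−2α}}. (6.16) It
follows from 2), 3) and the periodicity of h_N^{(−n)}(z); the small ε′ > 0 absorbs an order 𝒪((β_N^{(−n)})^{−2α}). Now
consider the family of a given scale n. Because of 2) there exists β^{(−n)} = B_n + 𝒪(B_n^{−1+2α}) + 𝒪(1). (6.17) In the
strip |Im z| < (κ/2)(β^{(−n)})^{−α} the members of the family are holomorphic functions bounded by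
N ≧ n: |h_N^{(−n)}(z)| < exp{(1 + ε′)(κ/2)²(β^{(−n)})^{1−2α}}. (6.18) This proves 4), [13], and completes the proof of
Theorem 2.»*  Part 2) (p.281): in `|z| < β^{−α}`, `h(z) = exp{−V(z)}`, `V(z) = βz² + ½λz⁴ + ⅓σz⁶ + Ṽ(z)`,
`|Ṽ(z)| < Dβ^{−2}`, with (p.267, (A₃)) «|β^{−1}λ|, |β^{−1}σ| are bounded by constants». Part 3) (p.281): for
`|z| > β^{−α}`, `|x| ≦ π`, `|y| < (κ/2)β^{−α}`: `|h(z)| < exp{βy² − pβ^{1−2α}}`. Part 4): with `β^{(−n)} := sup_{N≧n}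
β_N^{(−n)}`, the families are normal in the strips `|Im z| < (κ/2)(β^{(−n)})^{−α}`.

**What this file proves (kernel-checked, 0 sorry, standard axioms; theorems only, no definition, no named fact).**
Writing `β` for `β_N^{(−n)}`, `s = 1 − 2α`:
* **(6.16), SMALL-FIELD REGIME** `eq616_small`: if `h = exp{−V}`, `V = βz² + ½λz⁴ + ⅓σz⁶ + Ṽ` with `|Ṽ| ≤ Dβ^{−2}`,
  `|λ| ≤ c_λβ`, `|σ| ≤ c_σβ` (part 2) / (A₃)), `|z| ≤ β^{−α}` and `(Im z)² ≤ (κ/2)²β^{−2α}`, `β ≥ 1`, `α ≥ 0`, then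
  `|h(z)| ≤ exp{(κ/2)²β^{1−2α} + (½c_λ + ⅓c_σ)β^{1−4α} + Dβ^{−2}}` (`Re z² ≥ −(Im z)²`);
* **(6.16), LARGE-FIELD REGIME** `eq616_large`: if `|h(z)| < exp{βy² − pβ^{1−2α}}` (part 3)), `p ≥ 0`, `β ≥ 0`,
  `y² ≤ (κ/2)²β^{−2α}`, then `|h(z)| < exp{(κ/2)²β^{1−2α}}`;
* **(6.16)** `eq616`: either regime gives `|h(z)| ≤ exp{(1 + ε′)(κ/2)²β^{1−2α}}` as soon as the absorbed orders satisfy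
  `(½c_λ + ⅓c_σ)β^{1−4α} + Dβ^{−2} ≤ ε′(κ/2)²β^{1−2α}` («the small ε′ > 0 absorbs an order 𝒪(β^{−2α})»; an explicit
  threshold, no filter);
* **(6.17) ⟹ (6.18)** `eq618`: the bound is monotone in `β`, so `β_N^{(−n)} ≤ β^{(−n)}` turns (6.16) into the
  `N`-uniform (6.18) on the (smaller) strip of `β^{(−n)}`.

**Readings / scope (declared).** (i) `h`, `V`, `Ṽ`, `λ`, `σ` are letters; parts 2) and 3) are hypotheses (they are
Theorem 2's own earlier parts); «the periodicity of h» (reduction to `|x| ≤ π`) is not needed at this level and not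
formalised. (ii) `𝒪`-terms carry explicit nonnegative constants; strict `<` of the print is `≤` except in `eq616_large`.
(iii) Part 4) itself (normality = Montel's theorem from the uniform bound (6.18)) is NOT formalised — only the bound.

**Not claimed.** Theorem 2 parts 1)–4) themselves, (6.17)'s derivation from Proposition 2, Montel's theorem, anything
about lattice Yang–Mills or the Clay problem.
-/

namespace Literature.MathematicalPhysics.QuantumFieldTheory

namespace MullerSchiemann1987

namespace NormalFamilyBound

/-- `Re z² = (Re z)² − (Im z)² ≥ −(Im z)²`. [folklore] -/
private theorem re_sq_ge (z : ℂ) : -(z.im ^ 2) ≤ (z ^ 2).re := by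
  rw [show (z ^ 2).re = z.re * z.re - z.im * z.im by rw [sq, Complex.mul_re]]
  nlinarith [sq_nonneg z.re]

/-- `β · β^{−t} = β^{1−t}` (`β > 0`). [folklore] -/
private theorem mul_rpow_neg {β t : ℝ} (hβ : 0 < β) : β * β ^ (-t) = β ^ (1 - t) := by
  rw [sub_eq_add_neg, Real.rpow_add hβ, Real.rpow_one]

/-- **(6.16), THE SMALL-FIELD REGIME (from part 2))**: `h = exp{−V}`, `V = βz² + ½λz⁴ + ⅓σz⁶ + Ṽ`, `|Ṽ| ≤ Dβ^{−2}`,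
`|λ| ≤ c_λβ`, `|σ| ≤ c_σβ`, `|z| ≤ β^{−α}`, `(Im z)² ≤ (κ/2)²β^{−2α}`, `β ≥ 1`, `α ≥ 0` ⟹
`|h| ≤ exp{(κ/2)²β^{1−2α} + (½c_λ + ⅓c_σ)β^{1−4α} + Dβ^{−2}}`. [cite: MullerSchiemann1987, (6.16) p.281; Theorem 2 part 2) p.281] -/
theorem eq616_small {h V Vt lam sig z : ℂ} {β α κ D cl cs : ℝ} (hβ : 1 ≤ β) (hα : 0 ≤ α)
    (hh : h = Complex.exp (-V)) (hV : V = β * z ^ 2 + lam / 2 * z ^ 4 + sig / 3 * z ^ 6 + Vt)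
    (hVt : ‖Vt‖ ≤ D * β ^ (-(2:ℝ))) (hlam : ‖lam‖ ≤ cl * β) (hsig : ‖sig‖ ≤ cs * β)
    (hz : ‖z‖ ≤ β ^ (-α)) (hy : z.im ^ 2 ≤ (κ / 2) ^ 2 * β ^ (-(2 * α))) :
    ‖h‖ ≤ Real.exp ((κ / 2) ^ 2 * β ^ (1 - 2 * α) + (cl / 2 + cs / 3) * β ^ (1 - 4 * α) + D * β ^ (-(2:ℝ))) := by
  have hβ0 : 0 < β := by linarith
  rw [hh, Complex.norm_exp, Complex.neg_re]
  refine Real.exp_le_exp.mpr ?_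
  -- −Re V ≤ β y² + |λ|/2 |z|⁴ + |σ|/3 |z|⁶ + |Ṽ|
  have hE0 : 0 ≤ β ^ (-α) := Real.rpow_nonneg hβ0.le _
  have hz4 : ‖z‖ ^ 4 ≤ β ^ (-(4 * α)) := by
    have := pow_le_pow_left₀ (norm_nonneg _) hz 4
    rwa [← Real.rpow_natCast (β ^ (-α)) 4, ← Real.rpow_mul hβ0.le, show -α * ((4:ℕ):ℝ) = -(4 * α) by push_cast; ring]
      at this
  have hz6 : ‖z‖ ^ 6 ≤ β ^ (-(4 * α)) := by
    have h6 := pow_le_pow_left₀ (norm_nonneg _) hz 6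
    rw [← Real.rpow_natCast (β ^ (-α)) 6, ← Real.rpow_mul hβ0.le] at h6
    have : β ^ (-α * ((6:ℕ):ℝ)) ≤ β ^ (-(4 * α)) :=
      Real.rpow_le_rpow_of_exponent_le hβ (by push_cast; nlinarith)
    exact h6.trans this
  have t1 : -(β * z ^ 2).re ≤ β * z.im ^ 2 := by
    rw [Complex.re_ofReal_mul]; nlinarith [re_sq_ge z, hβ0]
  have t2 : -(lam / 2 * z ^ 4).re ≤ cl / 2 * β * β ^ (-(4 * α)) := by
    have a := Complex.abs_re_le_norm (lam / 2 * z ^ 4)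
    rw [norm_mul, norm_div, Complex.norm_ofNat, norm_pow] at a
    have b : ‖lam‖ / 2 * ‖z‖ ^ 4 ≤ cl * β / 2 * β ^ (-(4 * α)) :=
      mul_le_mul (by linarith) hz4 (by positivity) (by linarith [(norm_nonneg lam).trans hlam])
    have := neg_le_abs (lam / 2 * z ^ 4).re
    linarith
  have t3 : -(sig / 3 * z ^ 6).re ≤ cs / 3 * β * β ^ (-(4 * α)) := by
    have a := Complex.abs_re_le_norm (sig / 3 * z ^ 6)
    rw [norm_mul, norm_div, Complex.norm_ofNat, norm_pow] at a
    have b : ‖sig‖ / 3 * ‖z‖ ^ 6 ≤ cs * β / 3 * β ^ (-(4 * α)) :=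
      mul_le_mul (by linarith) hz6 (by positivity) (by linarith [(norm_nonneg sig).trans hsig])
    have := neg_le_abs (sig / 3 * z ^ 6).re
    linarith
  have t4 : -Vt.re ≤ D * β ^ (-(2:ℝ)) := by
    have := neg_le_abs Vt.re; have := Complex.abs_re_le_norm Vt; linarith
  have hy' : β * z.im ^ 2 ≤ (κ / 2) ^ 2 * β ^ (1 - 2 * α) := by
    have := mul_le_mul_of_nonneg_left hy hβ0.le
    rw [← mul_rpow_neg hβ0]; linarith
  have hF : β * β ^ (-(4 * α)) = β ^ (1 - 4 * α) := mul_rpow_neg hβ0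
  rw [hV]
  simp only [Complex.add_re, neg_add]
  have e2 : cl / 2 * β * β ^ (-(4 * α)) + cs / 3 * β * β ^ (-(4 * α)) = (cl / 2 + cs / 3) * β ^ (1 - 4 * α) := by
    rw [← hF]; ring
  linarith

/-- **(6.16), THE LARGE-FIELD REGIME (from part 3))**: `|h(z)| < exp{βy² − pβ^{1−2α}}`, `p ≥ 0`, `β ≥ 0`,
`y² ≤ (κ/2)²β^{−2α}` ⟹ `|h(z)| < exp{(κ/2)²β^{1−2α}}`. [cite: MullerSchiemann1987, (6.16) p.281; Theorem 2 part 3) p.281] -/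
theorem eq616_large {nh β α κ p y : ℝ} (hβ : 0 < β) (hp : 0 ≤ p)
    (h3 : nh < Real.exp (β * y ^ 2 - p * β ^ (1 - 2 * α))) (hy : y ^ 2 ≤ (κ / 2) ^ 2 * β ^ (-(2 * α))) :
    nh < Real.exp ((κ / 2) ^ 2 * β ^ (1 - 2 * α)) := by
  refine lt_of_lt_of_le h3 (Real.exp_le_exp.mpr ?_)
  have hy' : β * y ^ 2 ≤ (κ / 2) ^ 2 * β ^ (1 - 2 * α) := by
    have := mul_le_mul_of_nonneg_left hy hβ.le
    rw [← mul_rpow_neg hβ]; linarith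
  have : 0 ≤ p * β ^ (1 - 2 * α) := mul_nonneg hp (Real.rpow_nonneg hβ.le _)
  linarith

/-- **(6.16)**: in either regime, once «the small ε′ > 0 absorbs» the lower orders —
`(½c_λ + ⅓c_σ)β^{1−4α} + Dβ^{−2} ≤ ε′(κ/2)²β^{1−2α}` — the bound is `|h(z)| ≤ exp{(1 + ε′)(κ/2)²β^{1−2α}}`.
[cite: MullerSchiemann1987, (6.16) p.281 and p.282 L.1–2] -/
theorem eq616 {nh β α κ D cl cs ε' : ℝ}
    (hcase : nh ≤ Real.exp ((κ / 2) ^ 2 * β ^ (1 - 2 * α) + (cl / 2 + cs / 3) * β ^ (1 - 4 * α) + D * β ^ (-(2:ℝ))) ∨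
      nh < Real.exp ((κ / 2) ^ 2 * β ^ (1 - 2 * α)))
    (hrest : 0 ≤ (cl / 2 + cs / 3) * β ^ (1 - 4 * α) + D * β ^ (-(2:ℝ)))
    (habs : (cl / 2 + cs / 3) * β ^ (1 - 4 * α) + D * β ^ (-(2:ℝ)) ≤ ε' * ((κ / 2) ^ 2 * β ^ (1 - 2 * α))) :
    nh ≤ Real.exp ((1 + ε') * ((κ / 2) ^ 2 * β ^ (1 - 2 * α))) := by
  rcases hcase with h | h
  · exact h.trans (Real.exp_le_exp.mpr (by linarith))
  · exact h.le.trans (Real.exp_le_exp.mpr (by linarith))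

/-- **(6.17) ⟹ (6.18)**: the bound (6.16) is monotone in `β`, so with `β^{(−n)} := sup_{N≧n} β_N^{(−n)} ≥ β_N^{(−n)}`
every member satisfies `|h_N^{(−n)}(z)| ≤ exp{(1 + ε′)(κ/2)²(β^{(−n)})^{1−2α}}` (`α < ½`, `ε′ ≥ −1`).
[cite: MullerSchiemann1987, (6.17)–(6.18) p.282] -/
theorem eq618 {nh β βsup α κ ε' : ℝ} (hβ : 0 ≤ β) (hle : β ≤ βsup) (hα : α < 1 / 2) (hε : 0 ≤ 1 + ε')
    (h616 : nh ≤ Real.exp ((1 + ε') * ((κ / 2) ^ 2 * β ^ (1 - 2 * α)))) :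
    nh ≤ Real.exp ((1 + ε') * ((κ / 2) ^ 2 * βsup ^ (1 - 2 * α))) := by
  refine h616.trans (Real.exp_le_exp.mpr ?_)
  have h1 : β ^ (1 - 2 * α) ≤ βsup ^ (1 - 2 * α) := Real.rpow_le_rpow hβ hle (by linarith)
  have h2 : (κ / 2) ^ 2 * β ^ (1 - 2 * α) ≤ (κ / 2) ^ 2 * βsup ^ (1 - 2 * α) :=
    mul_le_mul_of_nonneg_left h1 (sq_nonneg _)
  exact mul_le_mul_of_nonneg_left h2 hε

/-- The strips shrink with `β`: `(κ/2)(β^{(−n)})^{−α} ≤ (κ/2)(β_N^{(−n)})^{−α}` for `β_N^{(−n)} ≤ β^{(−n)}` (`κ, α ≥ 0`),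
so (6.16) on the strip of `β_N^{(−n)}` covers the strip of (6.18). [cite: MullerSchiemann1987, (6.18) p.282] -/
theorem strip_mono {β βsup α κ : ℝ} (hβ : 0 < β) (hle : β ≤ βsup) (hα : 0 ≤ α) (hκ : 0 ≤ κ) :
    κ / 2 * βsup ^ (-α) ≤ κ / 2 * β ^ (-α) := by
  refine mul_le_mul_of_nonneg_left ?_ (by linarith)
  exact Real.rpow_le_rpow_of_nonpos hβ hle (by linarith)

end NormalFamilyBound

end MullerSchiemann1987

end Literature.MathematicalPhysics.QuantumFieldTheory
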